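import Literature.MathematicalPhysics.KineticTheory.PhaseSpacePoisson
import Mathlib.Analysis.SpecialFunctions.Trigonometric.Deriv
import HarnessLib

/-!
# Symbolic trigonometric polynomials on phase space (the class `𝒮(Ω)` of De Roeck–Huveneers, §3.1)

`Literature/MathematicalPhysics/KineticTheory/` — a SYMBOLIC calculus for the functions
`f(q, ω) = ∑_k f̂(k, ω) e^{ik·q}` "depending on the variable `q` through a finite number of Fourier
modes only" (W. De Roeck, F. Huveneers, CPAM 68 (2015), arXiv:1305.5127, §3.1 eq. (3.3)), on which
the operators of the perturbative scheme of §3 act mode by mode: the resonance cut-off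
`(𝓡 f)(q, ω) = ∑_k ρ_δ(k·ω) f̂(k, ω) e^{ik·q}`, the solution `u = ∑_k (1 - ρ_δ(k·ω))/(i k·ω) f̂(k,ω) e^{ik·q}`
of `L_D u = (Id - 𝓡) f`, and the bracket `L_D = {D, ·}` with `D = ½∑ω²`.

A term is REAL data `(pos, k, a, b)` standing for `a(δ, ω) cos(k·q) + b(δ, ω) sin(k·q)` (anchor
site `pos`, integer mode `k : Fin m → ℤ`, coefficient families `a b : ℝ → (Fin m → ℝ) → ℝ` in the
cut-off scale `δ` and the momenta `ω`); a trigonometric polynomial is a `List` of terms, evaluated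
by summation (`TrigPoly.ev`). No normal form is maintained: all operators act termwise and all
statements are about evaluations. Contents (all proved):

* `TrigTerm`, `TrigPoly`, `ev`, `ev_append`, scalar/functional multiples (`smulFun`), negation;
* the coordinate derivatives of a term (`partialQ_ev`, `partialP_ev`), smoothness (`contDiff_ev`)
  and angle-periodicity (`ev_update_add_two_pi`) of evaluations;
* `bracketD` = `{D, ·}` with `ev_bracketD` (`{D, a cos θ + b sin θ} = (k·ω)(b cos θ - a sin θ)`);
* `resCut ρ` = `𝓡` and `solve ρ` = `L_D⁻¹(Id - 𝓡)` for a cut-off profile `ρ` with `ρ = 1` near `0`,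
  with **`ev_bracketD_solve`: `{D, solve f} = f - 𝓡 f`** (eq. before (3.5): "A solution `u` is given
  by …"; termwise, so valid without uniqueness of the Fourier representation).

The general bracket `{f, g}` of two trigonometric polynomials (product-to-sum formulas) is in the
companion file `TrigPolyBracket.lean`. No named facts.
-/

noncomputable section

open Function Set Finset
open scoped ContDiff BigOperators

namespace Literature.MathematicalPhysics.KineticTheory.HeatConduction

variable {m : ℕ}

/-! ### Terms and evaluation -/

/-- A term `a(δ, ω) cos(k·q) + b(δ, ω) sin(k·q)` of a trigonometric polynomial in the angles with
momentum-dependent coefficients, anchored at the site `pos`. [cite: DeRoeckHuveneers2015, §3.1 eq. (3.2)–(3.3)] -/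
structure TrigTerm (m : ℕ) where
  /-- anchor site (the `x` of the local decomposition `f = ∑_x f_x`) -/
  pos : Fin m
  /-- Fourier mode `k ∈ ℤ^m` -/
  mode : Fin m → ℤ
  /-- coefficient of `cos(k·q)`, as a family in the cut-off scale `δ` -/
  cosCoeff : ℝ → (Fin m → ℝ) → ℝ
  /-- coefficient of `sin(k·q)` -/
  sinCoeff : ℝ → (Fin m → ℝ) → ℝ

/-- A (symbolic) trigonometric polynomial: a formal sum of terms. [cite: DeRoeckHuveneers2015, §3.1 eq. (3.3)] -/
abbrev TrigPoly (m : ℕ) : Type := List (TrigTerm m)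

/-- The phase `k·q = ∑_x k_x q_x` of the mode `k`. [folklore] -/
def modePhase (k : Fin m → ℤ) (q : Fin m → ℝ) : ℝ := ∑ x : Fin m, (k x : ℝ) * q x

/-- The frequency `k·ω` of the mode `k` (same formula, momenta instead of angles). [cite: DeRoeckHuveneers2015, §3.1 (`ρ_δ(k·ω)`)] -/
abbrev modeFreq (k : Fin m → ℤ) (w : Fin m → ℝ) : ℝ := modePhase k w

/-- The mode `k` as a real vector (direction of `∇_ω` in `k·∇_ω`). [folklore] -/
def modeVec (k : Fin m → ℤ) : Fin m → ℝ := fun x => (k x : ℝ)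

/-- `(k + k')·q = k·q + k'·q`. [folklore] -/
theorem modePhase_add (k k' : Fin m → ℤ) (q : Fin m → ℝ) :
    modePhase (k + k') q = modePhase k q + modePhase k' q := by
  simp only [modePhase, Pi.add_apply, Int.cast_add, add_mul, sum_add_distrib]

/-- `(k - k')·q = k·q - k'·q`. [folklore] -/
theorem modePhase_sub (k k' : Fin m → ℤ) (q : Fin m → ℝ) :
    modePhase (k - k') q = modePhase k q - modePhase k' q := by
  simp only [modePhase, Pi.sub_apply, Int.cast_sub, sub_mul, sum_sub_distrib]

/-- Updating one angle shifts the phase linearly: `k·(q[x ↦ s]) = k·q + k_x (s - q_x)`. [folklore] -/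
theorem modePhase_update (k : Fin m → ℤ) (q : Fin m → ℝ) (x : Fin m) (s : ℝ) :
    modePhase k (update q x s) = modePhase k q + (k x : ℝ) * (s - q x) := by
  unfold modePhase
  have : ∀ y, (k y : ℝ) * update q x s y = (k y : ℝ) * q y + (if y = x then (k x : ℝ) * (s - q x) else 0) := by
    intro y
    by_cases hy : y = x
    · subst hy; simp [update_self]; ring
    · simp [hy]
  simp only [this, sum_add_distrib, sum_ite_eq' univ x]
  simp

namespace TrigTerm

/-- Evaluation of a term at scale `δ` and phase point `z = (q, ω)`:
`a(δ, ω) cos(k·q) + b(δ, ω) sin(k·q)`. [cite: DeRoeckHuveneers2015, §3.1 eq. (3.3)] -/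
def ev (t : TrigTerm m) (δ : ℝ) (z : PhaseSpace m) : ℝ :=
  t.cosCoeff δ z.2 * Real.cos (modePhase t.mode z.1) + t.sinCoeff δ z.2 * Real.sin (modePhase t.mode z.1)

/-- Multiply both coefficients by a function of `(δ, ω)` (e.g. a cut-off `ρ_δ(k·ω)` or a partition
function `ϑ(ω)`). [folklore] -/
def smulFun (θ : ℝ → (Fin m → ℝ) → ℝ) (t : TrigTerm m) : TrigTerm m :=
  { t with cosCoeff := fun δ w => θ δ w * t.cosCoeff δ w, sinCoeff := fun δ w => θ δ w * t.sinCoeff δ w }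

/-- Evaluation of a functional multiple. [folklore] -/
@[simp] theorem ev_smulFun (θ : ℝ → (Fin m → ℝ) → ℝ) (t : TrigTerm m) (δ : ℝ) (z : PhaseSpace m) :
    (t.smulFun θ).ev δ z = θ δ z.2 * t.ev δ z := by
  simp only [ev, smulFun]; ring

/-- Negation of a term. [folklore] -/
def neg (t : TrigTerm m) : TrigTerm m :=
  { t with cosCoeff := fun δ w => -t.cosCoeff δ w, sinCoeff := fun δ w => -t.sinCoeff δ w }

/-- Evaluation of a negated term. [folklore] -/
@[simp] theorem ev_neg (t : TrigTerm m) (δ : ℝ) (z : PhaseSpace m) : t.neg.ev δ z = -t.ev δ z := by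
  simp only [ev, neg]; ring

/-! ### Coordinate derivatives of a term -/

/-- `∂_{q_x} (a cos(k·q) + b sin(k·q)) = k_x (b cos(k·q) - a sin(k·q))`. [folklore] -/
theorem partialQ_ev (t : TrigTerm m) (δ : ℝ) (x : Fin m) (z : PhaseSpace m) :
    partialQ x (t.ev δ) z = (t.mode x : ℝ) *
      (t.sinCoeff δ z.2 * Real.cos (modePhase t.mode z.1) - t.cosCoeff δ z.2 * Real.sin (modePhase t.mode z.1)) := by
  unfold partialQ
  have hph : ∀ s, modePhase t.mode (update z.1 x s) = modePhase t.mode z.1 + (t.mode x : ℝ) * (s - z.1 x) :=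
    fun s => modePhase_update t.mode z.1 x s
  have hlin : HasDerivAt (fun s => modePhase t.mode z.1 + (t.mode x : ℝ) * (s - z.1 x)) (t.mode x : ℝ) (z.1 x) := by
    have := ((hasDerivAt_id (z.1 x)).sub_const (z.1 x)).const_mul (t.mode x : ℝ) |>.const_add (modePhase t.mode z.1)
    simpa using this
  have h : HasDerivAt (fun s => t.ev δ (update z.1 x s, z.2))
      (t.cosCoeff δ z.2 * (-Real.sin (modePhase t.mode z.1) * (t.mode x : ℝ)) +
        t.sinCoeff δ z.2 * (Real.cos (modePhase t.mode z.1) * (t.mode x : ℝ))) (z.1 x) := by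
    simp only [ev, hph]
    have hc := (hlin.cos).const_mul (t.cosCoeff δ z.2)
    have hs := (hlin.sin).const_mul (t.sinCoeff δ z.2)
    have := hc.add hs
    simp only [sub_self, mul_zero, add_zero] at this
    exact this
  rw [h.deriv]
  ring

/-- `∂_{ω_x} (a cos(k·q) + b sin(k·q)) = (∂_x a) cos(k·q) + (∂_x b) sin(k·q)` for coefficients
differentiable at scale `δ`. [folklore] -/
theorem partialP_ev (t : TrigTerm m) {δ : ℝ} (ha : Differentiable ℝ (t.cosCoeff δ))
    (hb : Differentiable ℝ (t.sinCoeff δ)) (x : Fin m) (z : PhaseSpace m) :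
    partialP x (t.ev δ) z = fderiv ℝ (t.cosCoeff δ) z.2 (Pi.single x 1) * Real.cos (modePhase t.mode z.1) +
      fderiv ℝ (t.sinCoeff δ) z.2 (Pi.single x 1) * Real.sin (modePhase t.mode z.1) := by
  unfold partialP
  -- the slices `s ↦ a(ω[x ↦ s])`
  have hsl : ∀ {f : (Fin m → ℝ) → ℝ}, Differentiable ℝ f →
      HasDerivAt (fun s => f (update z.2 x s)) (fderiv ℝ f z.2 (Pi.single x 1)) (z.2 x) := by
    intro f hf
    have hu : HasDerivAt (fun s : ℝ => update z.2 x s) (Pi.single x (1 : ℝ)) (z.2 x) := by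
      have : (fun s : ℝ => update z.2 x s) = fun s => z.2 + (s - z.2 x) • (Pi.single x (1 : ℝ) : Fin m → ℝ) := by
        funext s; ext y
        by_cases hy : y = x
        · subst hy; simp
        · simp [hy]
      rw [this]
      have h1 : HasDerivAt (fun s : ℝ => (s - z.2 x) • (Pi.single x (1 : ℝ) : Fin m → ℝ))
          ((1 : ℝ) • (Pi.single x (1 : ℝ) : Fin m → ℝ)) (z.2 x) :=
        ((hasDerivAt_id (z.2 x)).sub_const (z.2 x)).smul_const _
      simpa using h1.const_add z.2
    have := (hf (update z.2 x (z.2 x))).hasFDerivAt.comp_hasDerivAt (z.2 x) hu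
    simp only [update_eq_self] at this
    exact this
  have h : HasDerivAt (fun s => t.ev δ (z.1, update z.2 x s))
      (fderiv ℝ (t.cosCoeff δ) z.2 (Pi.single x 1) * Real.cos (modePhase t.mode z.1) +
        fderiv ℝ (t.sinCoeff δ) z.2 (Pi.single x 1) * Real.sin (modePhase t.mode z.1)) (z.2 x) := by
    simp only [ev]
    exact ((hsl ha).mul_const _).add ((hsl hb).mul_const _)
  exact h.deriv

/-! ### Smoothness and periodicity of evaluations -/

/-- The phase `k·q` is a smooth function of the phase point. [folklore] -/
theorem contDiff_modePhase_fst (k : Fin m → ℤ) {n : WithTop ℕ∞} :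
    ContDiff ℝ n fun z : PhaseSpace m => modePhase k z.1 := by
  unfold modePhase
  exact ContDiff.sum fun x _ => contDiff_const.mul ((contDiff_apply ℝ ℝ x).comp contDiff_fst)

/-- A term with `C^n` coefficients (at scale `δ`) evaluates to a `C^n` function. [folklore] -/
theorem contDiff_ev (t : TrigTerm m) {δ : ℝ} {n : WithTop ℕ∞} (ha : ContDiff ℝ n (t.cosCoeff δ))
    (hb : ContDiff ℝ n (t.sinCoeff δ)) : ContDiff ℝ n (t.ev δ) := by
  unfold ev
  exact ((ha.comp contDiff_snd).mul (contDiff_modePhase_fst t.mode).cos).add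
    ((hb.comp contDiff_snd).mul (contDiff_modePhase_fst t.mode).sin)

/-- Evaluations are `2π`-periodic in every angle (integer modes). [cite: DeRoeckHuveneers2015, §3.1 (functions on `Ω = (𝕋 × ℝ)^N`)] -/
theorem ev_update_add_two_pi (t : TrigTerm m) (δ : ℝ) (z : PhaseSpace m) (x : Fin m) :
    t.ev δ (update z.1 x (z.1 x + 2 * Real.pi), z.2) = t.ev δ z := by
  simp only [ev, modePhase_update]
  have : (t.mode x : ℝ) * (z.1 x + 2 * Real.pi - z.1 x) = (t.mode x : ℝ) * (2 * Real.pi) := by ring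
  rw [this, Real.cos_add_int_mul_two_pi, Real.sin_add_int_mul_two_pi]

end TrigTerm

namespace TrigPoly

/-- Evaluation of a trigonometric polynomial: the sum of the evaluations of its terms.
[cite: DeRoeckHuveneers2015, §3.1 eq. (3.3)] -/
def ev (F : TrigPoly m) (δ : ℝ) (z : PhaseSpace m) : ℝ := (F.map fun t => t.ev δ z).sum

/-- Evaluation of the empty polynomial. [folklore] -/
@[simp] theorem ev_nil (δ : ℝ) (z : PhaseSpace m) : ev ([] : TrigPoly m) δ z = 0 := rfl

/-- Evaluation of a cons. [folklore] -/
@[simp] theorem ev_cons (t : TrigTerm m) (F : TrigPoly m) (δ : ℝ) (z : PhaseSpace m) :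
    ev (t :: F) δ z = t.ev δ z + ev F δ z := by
  simp [ev]

/-- **Addition is concatenation.** [folklore] -/
@[simp] theorem ev_append (F G : TrigPoly m) (δ : ℝ) (z : PhaseSpace m) : ev (F ++ G) δ z = ev F δ z + ev G δ z := by
  simp [ev, List.sum_append]

/-- Evaluation as a function is the sum of the term functions. [folklore] -/
theorem ev_eq_sum (F : TrigPoly m) (δ : ℝ) : ev F δ = fun z => (F.map fun t => t.ev δ z).sum := rfl

/-- Evaluation of a flat-map (`bind`). [folklore] -/
theorem ev_flatMap {α : Type*} (l : List α) (f : α → TrigPoly m) (δ : ℝ) (z : PhaseSpace m) :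
    ev (l.flatMap f) δ z = (l.map fun a => ev (f a) δ z).sum := by
  induction l with
  | nil => rfl
  | cons a l ih => simp [List.flatMap_cons, ih]

/-- Evaluation of a `map` of terms under a termwise operation with known effect. [folklore] -/
theorem ev_map (F : TrigPoly m) (g : TrigTerm m → TrigTerm m) (δ : ℝ) (z : PhaseSpace m) :
    ev (F.map g) δ z = (F.map fun t => (g t).ev δ z).sum := by
  simp only [ev, List.map_map]
  rfl

/-- Functional multiples, termwise. [folklore] -/
def smulFun (θ : ℝ → (Fin m → ℝ) → ℝ) (F : TrigPoly m) : TrigPoly m := F.map (TrigTerm.smulFun θ)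

/-- Evaluation of a functional multiple: `ev (θ • F) = θ · ev F`. [folklore] -/
@[simp] theorem ev_smulFun (θ : ℝ → (Fin m → ℝ) → ℝ) (F : TrigPoly m) (δ : ℝ) (z : PhaseSpace m) :
    ev (smulFun θ F) δ z = θ δ z.2 * ev F δ z := by
  induction F with
  | nil => simp [smulFun]
  | cons t F ih =>
    simp only [smulFun, List.map_cons, ev_cons, TrigTerm.ev_smulFun] at ih ⊢
    rw [ih]; ring

/-- Real multiples. [folklore] -/
def constSMul (c : ℝ) (F : TrigPoly m) : TrigPoly m := smulFun (fun _ _ => c) F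

/-- Evaluation of a real multiple. [folklore] -/
@[simp] theorem ev_constSMul (c : ℝ) (F : TrigPoly m) (δ : ℝ) (z : PhaseSpace m) :
    ev (constSMul c F) δ z = c * ev F δ z := ev_smulFun _ F δ z

/-- Negation, termwise. [folklore] -/
def neg (F : TrigPoly m) : TrigPoly m := F.map TrigTerm.neg

/-- Evaluation of a negation. [folklore] -/
@[simp] theorem ev_neg (F : TrigPoly m) (δ : ℝ) (z : PhaseSpace m) : ev (neg F) δ z = -ev F δ z := by
  induction F with
  | nil => simp [neg]
  | cons t F ih =>
    simp only [neg, List.map_cons, ev_cons, TrigTerm.ev_neg] at ih ⊢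
    rw [ih]; ring

/-- Smoothness of evaluations: all coefficients `C^n` at scale `δ` ⇒ `ev F δ ∈ C^n`. [folklore] -/
theorem contDiff_ev (F : TrigPoly m) {δ : ℝ} {n : WithTop ℕ∞}
    (h : ∀ t ∈ F, ContDiff ℝ n (t.cosCoeff δ) ∧ ContDiff ℝ n (t.sinCoeff δ)) : ContDiff ℝ n (ev F δ) := by
  induction F with
  | nil => exact contDiff_const
  | cons t F ih =>
    have ht := h t (by simp)
    have hF := ih fun s hs => h s (by simp [hs])
    have e : ev (t :: F) δ = fun z => t.ev δ z + ev F δ z := funext fun z => ev_cons t F δ z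
    rw [e]
    exact (t.contDiff_ev ht.1 ht.2).add hF

/-- Evaluations are angle-periodic (functions on `Ω_m = (𝕋 × ℝ)^m`). [cite: DeRoeckHuveneers2015, §3.1] -/
theorem ev_update_add_two_pi (F : TrigPoly m) (δ : ℝ) (z : PhaseSpace m) (x : Fin m) :
    ev F δ (update z.1 x (z.1 x + 2 * Real.pi), z.2) = ev F δ z := by
  induction F with
  | nil => rfl
  | cons t F ih => simp only [ev_cons, ih, TrigTerm.ev_update_add_two_pi]

/-- Differentiability of a term evaluation with differentiable coefficients. [folklore] -/
theorem _root_.Literature.MathematicalPhysics.KineticTheory.HeatConduction.TrigTerm.differentiable_ev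
    (t : TrigTerm m) {δ : ℝ} (ha : Differentiable ℝ (t.cosCoeff δ)) (hb : Differentiable ℝ (t.sinCoeff δ)) :
    Differentiable ℝ (t.ev δ) := by
  have hph : Differentiable ℝ fun z : PhaseSpace m => modePhase t.mode z.1 :=
    (TrigTerm.contDiff_modePhase_fst t.mode (n := 1)).differentiable one_ne_zero
  unfold TrigTerm.ev
  exact ((ha.comp differentiable_snd).mul hph.cos).add ((hb.comp differentiable_snd).mul hph.sin)

/-- Differentiability of evaluations with differentiable coefficients. [folklore] -/
theorem differentiable_ev (F : TrigPoly m) {δ : ℝ}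
    (h : ∀ t ∈ F, Differentiable ℝ (t.cosCoeff δ) ∧ Differentiable ℝ (t.sinCoeff δ)) :
    Differentiable ℝ (ev F δ) := by
  induction F with
  | nil => exact differentiable_const 0
  | cons t F ih =>
    have ht := h t (by simp)
    have hF := ih fun s hs => h s (by simp [hs])
    have e : ev (t :: F) δ = fun z => t.ev δ z + ev F δ z := funext fun z => ev_cons t F δ z
    rw [e]
    exact (t.differentiable_ev ht.1 ht.2).add hF

/-- Coordinate derivative `∂_{q_x}` of an evaluation, termwise (differentiable coefficients).
[folklore] -/
theorem partialQ_ev (F : TrigPoly m) {δ : ℝ} (x : Fin m) (z : PhaseSpace m)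
    (h : ∀ t ∈ F, Differentiable ℝ (t.cosCoeff δ) ∧ Differentiable ℝ (t.sinCoeff δ)) :
    partialQ x (ev F δ) z = (F.map fun t => partialQ x (t.ev δ) z).sum := by
  induction F with
  | nil => simp [partialQ]
  | cons t F ih =>
    have ht := h t (by simp)
    have hF : ∀ s ∈ F, Differentiable ℝ (s.cosCoeff δ) ∧ Differentiable ℝ (s.sinCoeff δ) :=
      fun s hs => h s (by simp [hs])
    have e : ev (t :: F) δ = t.ev δ + ev F δ := funext fun z => ev_cons t F δ z
    rw [e, partialQ_add (t.differentiable_ev ht.1 ht.2) (differentiable_ev F hF), ih hF]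
    simp

/-- Coordinate derivative `∂_{ω_x}` of an evaluation, termwise (differentiable coefficients).
[folklore] -/
theorem partialP_ev (F : TrigPoly m) {δ : ℝ} (x : Fin m) (z : PhaseSpace m)
    (h : ∀ t ∈ F, Differentiable ℝ (t.cosCoeff δ) ∧ Differentiable ℝ (t.sinCoeff δ)) :
    partialP x (ev F δ) z = (F.map fun t => partialP x (t.ev δ) z).sum := by
  induction F with
  | nil => simp [partialP]
  | cons t F ih =>
    have ht := h t (by simp)
    have hF : ∀ s ∈ F, Differentiable ℝ (s.cosCoeff δ) ∧ Differentiable ℝ (s.sinCoeff δ) :=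
      fun s hs => h s (by simp [hs])
    have e : ev (t :: F) δ = t.ev δ + ev F δ := funext fun z => ev_cons t F δ z
    rw [e, partialP_add (t.differentiable_ev ht.1 ht.2) (differentiable_ev F hF), ih hF]
    simp

end TrigPoly

/-! ### The operators `L_D = {D, ·}`, `𝓡` and `L_D⁻¹(Id - 𝓡)` -/

/-- The kinetic energy `D(ω) = ½ ∑_x ω_x²` of the rotor chain. [cite: DeRoeckHuveneers2015, §2.1 eq. (2.1)] -/
def kineticEnergy (m : ℕ) (z : PhaseSpace m) : ℝ := ∑ x : Fin m, z.2 x ^ 2 / 2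

/-- `D` is smooth. [folklore] -/
theorem contDiff_kineticEnergy (m : ℕ) {n : WithTop ℕ∞} : ContDiff ℝ n (kineticEnergy m) := by
  unfold kineticEnergy; fun_prop

/-- `∂_{q_x} D = 0`. [folklore] -/
theorem partialQ_kineticEnergy (x : Fin m) (z : PhaseSpace m) : partialQ x (kineticEnergy m) z = 0 := by
  simp [partialQ, kineticEnergy]

/-- `∂_{ω_x} D = ω_x`. [folklore] -/
theorem partialP_kineticEnergy (x : Fin m) (z : PhaseSpace m) : partialP x (kineticEnergy m) z = z.2 x := by
  unfold partialP kineticEnergy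
  have h : ∀ t : ℝ, HasDerivAt (fun t : ℝ => ∑ y : Fin m, (update z.2 x t) y ^ 2 / 2)
      (∑ y : Fin m, if y = x then t else 0) t := by
    intro t
    refine HasDerivAt.fun_sum fun y _ => ?_
    by_cases hy : y = x
    · subst hy
      rw [if_pos rfl]
      simp only [update_self]
      have h1 : HasDerivAt (fun s : ℝ => s ^ 2 / 2) (↑(2 : ℕ) * t ^ (2 - 1) / 2) t := (hasDerivAt_pow 2 t).div_const 2
      exact h1.congr_deriv (by norm_num)
    · simp only [update_of_ne hy, hy, if_false]
      exact hasDerivAt_const _ _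
  rw [(h (z.2 x)).deriv]
  simp [sum_ite_eq']

/-- `{D, f} = ∑_x ω_x ∂_{q_x} f`. [cite: DeRoeckHuveneers2015, §3.1 (`L_D = {D, ·}`)] -/
theorem poisson_kineticEnergy (f : PhaseSpace m → ℝ) (z : PhaseSpace m) :
    poisson (kineticEnergy m) f z = ∑ x : Fin m, z.2 x * partialQ x f z := by
  unfold poisson
  exact sum_congr rfl fun x _ => by rw [partialP_kineticEnergy, partialQ_kineticEnergy]; ring

namespace TrigTerm

/-- `L_D` on a term: `{D, a cos(k·q) + b sin(k·q)} = (k·ω)(b cos(k·q) - a sin(k·q))`, i.e.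
`(k, a, b) ↦ (k, (k·ω) b, -(k·ω) a)`. [cite: DeRoeckHuveneers2015, §3.1] -/
def bracketD (t : TrigTerm m) : TrigTerm m :=
  { t with
    cosCoeff := fun δ w => modeFreq t.mode w * t.sinCoeff δ w
    sinCoeff := fun δ w => -(modeFreq t.mode w * t.cosCoeff δ w) }

/-- Evaluation of `L_D t`. [folklore] -/
theorem ev_bracketD (t : TrigTerm m) (δ : ℝ) (z : PhaseSpace m) :
    t.bracketD.ev δ z = modeFreq t.mode z.2 *
      (t.sinCoeff δ z.2 * Real.cos (modePhase t.mode z.1) - t.cosCoeff δ z.2 * Real.sin (modePhase t.mode z.1)) := by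
  simp only [ev, bracketD]; ring

/-- **`{D, ev t} = ev (L_D t)`**: the symbolic `L_D` is the bracket with the kinetic energy.
[cite: DeRoeckHuveneers2015, §3.1] -/
theorem poisson_kineticEnergy_ev (t : TrigTerm m) (δ : ℝ) (z : PhaseSpace m) :
    poisson (kineticEnergy m) (t.ev δ) z = t.bracketD.ev δ z := by
  rw [poisson_kineticEnergy, ev_bracketD]
  simp only [partialQ_ev, modeFreq, modePhase]
  rw [sum_mul]
  exact sum_congr rfl fun x _ => by ring

/-- The resonance cut-off `𝓡` on a term: multiply by `ρ_δ(k·ω) = ρ(k·ω/δ)`.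
[cite: DeRoeckHuveneers2015, §3.1 (definition of `𝓡`)] -/
def resCut (ρ : ℝ → ℝ) (t : TrigTerm m) : TrigTerm m := t.smulFun fun δ w => ρ (modeFreq t.mode w / δ)

/-- Evaluation of `𝓡 t`. [folklore] -/
theorem ev_resCut (ρ : ℝ → ℝ) (t : TrigTerm m) (δ : ℝ) (z : PhaseSpace m) :
    (t.resCut ρ).ev δ z = ρ (modeFreq t.mode z.2 / δ) * t.ev δ z :=
  ev_smulFun _ t δ z

/-- The divided cut-off `φ_δ(s) = (1 - ρ(s/δ))/s` (value `0` at `s = 0`, the correct one when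
`ρ(0) = 1`). [cite: DeRoeckHuveneers2015, §3.1 ("`(1 - ρ_δ(k·ω))/(i k·ω)`")] -/
def cutDiv (ρ : ℝ → ℝ) (δ s : ℝ) : ℝ := (1 - ρ (s / δ)) / s

/-- `s φ_δ(s) = 1 - ρ_δ(s)` for all `s`, given `ρ(0) = 1`. [folklore] -/
theorem mul_cutDiv {ρ : ℝ → ℝ} (hρ : ρ 0 = 1) (δ s : ℝ) : s * cutDiv ρ δ s = 1 - ρ (s / δ) := by
  unfold cutDiv
  rcases eq_or_ne s 0 with rfl | hs
  · simp [hρ]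
  · field_simp

/-- The solution operator `L_D⁻¹(Id - 𝓡)` on a term: `(k, a, b) ↦ (k, -φ_δ(k·ω) b, φ_δ(k·ω) a)`
("`u = ∑_k (1 - ρ_δ(k·ω))/(i k·ω) f̂(k, ω) e^{ik·q}`"). [cite: DeRoeckHuveneers2015, §3.1] -/
def solve (ρ : ℝ → ℝ) (t : TrigTerm m) : TrigTerm m :=
  { t with
    cosCoeff := fun δ w => -(cutDiv ρ δ (modeFreq t.mode w) * t.sinCoeff δ w)
    sinCoeff := fun δ w => cutDiv ρ δ (modeFreq t.mode w) * t.cosCoeff δ w }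

/-- **The homological equation, termwise**: `L_D (solve t) = t - 𝓡 t` in evaluation, for a cut-off
profile with `ρ(0) = 1`. [cite: DeRoeckHuveneers2015, §3.1 ("the equation `L_D u = (Id - 𝓡) f` can be solved in `𝒮(Ω)`")] -/
theorem ev_bracketD_solve {ρ : ℝ → ℝ} (hρ : ρ 0 = 1) (t : TrigTerm m) (δ : ℝ) (z : PhaseSpace m) :
    (t.solve ρ).bracketD.ev δ z = t.ev δ z - (t.resCut ρ).ev δ z := by
  have key := mul_cutDiv hρ δ (modeFreq t.mode z.2)
  rw [ev_resCut]
  simp only [ev, bracketD, solve]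
  have e1 : modeFreq t.mode z.2 * (cutDiv ρ δ (modeFreq t.mode z.2) * t.cosCoeff δ z.2) =
      (1 - ρ (modeFreq t.mode z.2 / δ)) * t.cosCoeff δ z.2 := by rw [← mul_assoc, key]
  have e2 : modeFreq t.mode z.2 * -(cutDiv ρ δ (modeFreq t.mode z.2) * t.sinCoeff δ z.2) =
      -((1 - ρ (modeFreq t.mode z.2 / δ)) * t.sinCoeff δ z.2) := by rw [mul_neg, ← mul_assoc, key]
  rw [e1, e2]
  ring

/-- `solve` keeps the anchor. [folklore] -/
@[simp] theorem pos_solve (ρ : ℝ → ℝ) (t : TrigTerm m) : (t.solve ρ).pos = t.pos := rfl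
/-- `solve` keeps the mode. [folklore] -/
@[simp] theorem mode_solve (ρ : ℝ → ℝ) (t : TrigTerm m) : (t.solve ρ).mode = t.mode := rfl
/-- `resCut` keeps the anchor. [folklore] -/
@[simp] theorem pos_resCut (ρ : ℝ → ℝ) (t : TrigTerm m) : (t.resCut ρ).pos = t.pos := rfl
/-- `resCut` keeps the mode. [folklore] -/
@[simp] theorem mode_resCut (ρ : ℝ → ℝ) (t : TrigTerm m) : (t.resCut ρ).mode = t.mode := rfl
/-- `bracketD` keeps the anchor. [folklore] -/
@[simp] theorem pos_bracketD (t : TrigTerm m) : t.bracketD.pos = t.pos := rfl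
/-- `bracketD` keeps the mode. [folklore] -/
@[simp] theorem mode_bracketD (t : TrigTerm m) : t.bracketD.mode = t.mode := rfl
/-- `smulFun` keeps the anchor. [folklore] -/
@[simp] theorem pos_smulFun (θ : ℝ → (Fin m → ℝ) → ℝ) (t : TrigTerm m) : (t.smulFun θ).pos = t.pos := rfl
/-- `smulFun` keeps the mode. [folklore] -/
@[simp] theorem mode_smulFun (θ : ℝ → (Fin m → ℝ) → ℝ) (t : TrigTerm m) : (t.smulFun θ).mode = t.mode := rfl
/-- `neg` keeps the anchor. [folklore] -/
@[simp] theorem pos_neg (t : TrigTerm m) : t.neg.pos = t.pos := rfl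
/-- `neg` keeps the mode. [folklore] -/
@[simp] theorem mode_neg (t : TrigTerm m) : t.neg.mode = t.mode := rfl

end TrigTerm

namespace TrigPoly

/-- `L_D` on a polynomial, termwise. [cite: DeRoeckHuveneers2015, §3.1] -/
def bracketD (F : TrigPoly m) : TrigPoly m := F.map TrigTerm.bracketD

/-- `𝓡` on a polynomial, termwise. [cite: DeRoeckHuveneers2015, §3.1] -/
def resCut (ρ : ℝ → ℝ) (F : TrigPoly m) : TrigPoly m := F.map (TrigTerm.resCut ρ)

/-- `L_D⁻¹(Id - 𝓡)` on a polynomial, termwise. [cite: DeRoeckHuveneers2015, §3.1] -/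
def solve (ρ : ℝ → ℝ) (F : TrigPoly m) : TrigPoly m := F.map (TrigTerm.solve ρ)

/-- **`{D, ev F} = ev (L_D F)`** (differentiable coefficients at scale `δ`). [cite: DeRoeckHuveneers2015, §3.1] -/
theorem poisson_kineticEnergy_ev (F : TrigPoly m) {δ : ℝ} (z : PhaseSpace m)
    (h : ∀ t ∈ F, Differentiable ℝ (t.cosCoeff δ) ∧ Differentiable ℝ (t.sinCoeff δ)) :
    poisson (kineticEnergy m) (ev F δ) z = ev (bracketD F) δ z := by
  rw [poisson_kineticEnergy]
  simp only [partialQ_ev F _ z h]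
  unfold bracketD
  rw [ev_map]
  -- exchange the finite sum over sites with the list sum over terms
  induction F with
  | nil => simp
  | cons t F ih =>
    have hF : ∀ s ∈ F, Differentiable ℝ (s.cosCoeff δ) ∧ Differentiable ℝ (s.sinCoeff δ) :=
      fun s hs => h s (by simp [hs])
    simp only [List.map_cons, List.sum_cons, mul_add, sum_add_distrib]
    rw [ih hF, ← t.poisson_kineticEnergy_ev δ z, poisson_kineticEnergy]

/-- **The homological equation**: `ev (L_D (solve F)) = ev F - ev (𝓡 F)` (`ρ(0) = 1`).
[cite: DeRoeckHuveneers2015, §3.1] -/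
theorem ev_bracketD_solve {ρ : ℝ → ℝ} (hρ : ρ 0 = 1) (F : TrigPoly m) (δ : ℝ) (z : PhaseSpace m) :
    ev (bracketD (solve ρ F)) δ z = ev F δ z - ev (resCut ρ F) δ z := by
  induction F with
  | nil => simp [bracketD, solve, resCut]
  | cons t F ih =>
    simp only [bracketD, solve, resCut, List.map_cons, ev_cons] at ih ⊢
    rw [TrigTerm.ev_bracketD_solve hρ, ih]
    ring

/-- Evaluation of `𝓡 F`, termwise. [folklore] -/
theorem ev_resCut (ρ : ℝ → ℝ) (F : TrigPoly m) (δ : ℝ) (z : PhaseSpace m) :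
    ev (resCut ρ F) δ z = (F.map fun t => ρ (modeFreq t.mode z.2 / δ) * t.ev δ z).sum := by
  unfold resCut
  rw [ev_map]
  simp only [TrigTerm.ev_resCut]

end TrigPoly

end Literature.MathematicalPhysics.KineticTheory.HeatConduction

end
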